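import Literature.Analysis.Calculus.SardProofs
import Mathlib.Geometry.Manifold.MFDeriv.FDeriv
import Mathlib.Geometry.Manifold.ContMDiff.NormedSpace
import Mathlib.Geometry.Manifold.Instances.Real
import Mathlib.MeasureTheory.Measure.Lebesgue.Complex
import Mathlib.MeasureTheory.Measure.Haar.NormedSpace
import Mathlib.MeasureTheory.Measure.OpenPos

/-!
# A small common regular value of two planar composites (Sard–Brown)
(registered helper `helper_commonRegularValue` of the stub `stub_normalWitnessTransfer`, line
`cross-cap-laurent`, crux `GromovRecognitionRelEnd`, item stmt-SmoothPoincare4-11009)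

Setting: `X` a Hausdorff second-countable smooth `4`-manifold, `U ⊆ X` open, `g : X → ℂ` smooth
on `U`, `u v : ℂ → X` smooth, `A ⊆ ℂ` finite, `η > 0`.  Claim: there is `s : ℂ` with `‖s‖ < η`,
`s ∉ A`, which is a regular value of both real-smooth composites `g ∘ u` (on the open set
`u ⁻¹' U`) and `g ∘ v` (on `v ⁻¹' U`): the (manifold) derivative is onto at every preimage of `s`
in these open sets.

Proof (Sard's theorem and Brown's corollary: J. Milnor, *Topology from the Differentiable
Viewpoint* (1965), §2 p. 10 and §3 pp. 16–17; A. Sard, Bull. AMS 48 (1942), Thms. 4.1, 7.2).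
The composites are `C^∞` maps `ℂ → ℂ` of real vector spaces on the open preimages of `U`, so by
the tree's Sard theorem for maps of finite-dimensional real normed spaces
(`Literature.Analysis.Calculus.measure_image_setOf_not_surjective_fderiv_eq_zero`; Lebesgue
measure on `ℂ` is an additive Haar measure) both sets of critical values are Lebesgue-null, the
manifold derivative between vector spaces being the Fréchet derivative (`mfderiv_eq_fderiv`).
The finite set `A` is null, a null set cannot contain the ball `B(0, η)` of positive measure,
and any point of the ball outside the three null sets is the required `s`.
No new definitions.
-/

noncomputable section

open scoped Manifold ContDiff Topology
open Set Function MeasureTheory Metric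

-- the prescribed namespace `Summit.<P>.<Sub>.…` duplicates `SmoothPoincare4` (P = Sub)
set_option linter.dupNamespace false

namespace Summit.SmoothPoincare4.SmoothPoincare4.Theorems.GromovRecognitionRelEnd.CrossCapLaurent

namespace HelperCommonRegularValue

/-- **Sard's theorem for a planar composite.** For `g : X → ℂ` smooth on the open set `U` of a
smooth `4`-manifold `X` and `u : ℂ → X` smooth, the critical values of the real-smooth map
`g ∘ u` on the open set `u ⁻¹' U` (values at points where the derivative is not onto) form a
Lebesgue-null subset of `ℂ`. [cite: MilnorTDV1965, §3, Theorem p. 16] -/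
theorem volume_image_not_surjective_mfderiv_comp_eq_zero {X : Type*} [TopologicalSpace X]
    [ChartedSpace (EuclideanSpace ℝ (Fin 4)) X] [IsManifold (𝓡 4) ∞ X] {U : Set X} {g : X → ℂ}
    {u : ℂ → X} (hU : IsOpen U) (hg : ContMDiffOn (𝓡 4) 𝓘(ℝ, ℂ) ∞ g U)
    (hu : ContMDiff 𝓘(ℝ, ℂ) (𝓡 4) ∞ u) :
    volume ((fun z => g (u z)) '' {z ∈ u ⁻¹' U |
      ¬ Surjective (mfderiv 𝓘(ℝ, ℂ) 𝓘(ℝ, ℂ) (fun z => g (u z)) z)}) = 0 := by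
  have hΩ : IsOpen (u ⁻¹' U) := hU.preimage hu.continuous
  have hcomp : ContMDiffOn 𝓘(ℝ, ℂ) 𝓘(ℝ, ℂ) ∞ (g ∘ u) (u ⁻¹' U) :=
    hg.comp hu.contMDiffOn fun _ hz => hz
  have hcd : ContDiffOn ℝ ∞ (fun z => g (u z)) (u ⁻¹' U) :=
    contMDiffOn_iff_contDiffOn.1 hcomp
  have hS := Literature.Analysis.Calculus.measure_image_setOf_not_surjective_fderiv_eq_zero
    (volume : Measure ℂ) hΩ hcd
  simp only [mfderiv_eq_fderiv]
  exact hS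

/-- **A regular value from outside the critical values.** If `s` is not a critical value of
`g ∘ u` on `u ⁻¹' U`, then the manifold derivative of `g ∘ u` is onto at every `z` with
`u z ∈ U` and `g (u z) = s`. [folklore] -/
theorem surjective_mfderiv_of_notMem {X : Type*} [TopologicalSpace X]
    [ChartedSpace (EuclideanSpace ℝ (Fin 4)) X] {U : Set X} {g : X → ℂ} {u : ℂ → X} {s : ℂ}
    (hs : s ∉ (fun z => g (u z)) '' {z ∈ u ⁻¹' U |
      ¬ Surjective (mfderiv 𝓘(ℝ, ℂ) 𝓘(ℝ, ℂ) (fun z => g (u z)) z)}) :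
    ∀ z : ℂ, u z ∈ U → g (u z) = s →
      Surjective (mfderiv 𝓘(ℝ, ℂ) 𝓘(ℝ, ℂ) (fun z => g (u z)) z) := by
  intro z hzU hzs
  by_contra hdz
  exact hs ⟨z, ⟨hzU, hdz⟩, hzs⟩

end HelperCommonRegularValue

open HelperCommonRegularValue in
/-- **A small common regular value (Sard–Brown).** For `g : X → ℂ` smooth on the open set `U` of
a smooth `4`-manifold `X`, smooth `u v : ℂ → X`, a finite set `A ⊆ ℂ` and `η > 0`, there is
`s : ℂ` with `‖s‖ < η`, `s ∉ A`, which is a regular value of both composites `g ∘ u` on `u ⁻¹' U`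
and `g ∘ v` on `v ⁻¹' U` (derivative onto at every preimage): the two sets of critical values
are Lebesgue-null by Sard's theorem, `A` is null, and the ball `B(0, η)` has positive measure.
[cite: MilnorTDV1965, §3, Theorem p. 16 and Corollary (Brown) p. 17] -/
theorem helper_commonRegularValue : ∀ (X : Type) [TopologicalSpace X] [T2Space X] [SecondCountableTopology X] [ChartedSpace (EuclideanSpace ℝ (Fin 4)) X] [IsManifold (𝓡 4) ∞ X] (U : Set X) (g : X → ℂ) (u v : ℂ → X) (A : Set ℂ) (η : ℝ), IsOpen U → ContMDiffOn (𝓡 4) 𝓘(ℝ, ℂ) ∞ g U → ContMDiff 𝓘(ℝ, ℂ) (𝓡 4) ∞ u → ContMDiff 𝓘(ℝ, ℂ) (𝓡 4) ∞ v → A.Finite → 0 < η → ∃ s : ℂ, ‖s‖ < η ∧ s ∉ A ∧ (∀ z : ℂ, u z ∈ U → g (u z) = s → Function.Surjective (mfderiv 𝓘(ℝ, ℂ) 𝓘(ℝ, ℂ) (fun z => g (u z)) z)) ∧ (∀ w : ℂ, v w ∈ U → g (v w) = s → Function.Surjective (mfderiv 𝓘(ℝ, ℂ) 𝓘(ℝ,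 ℂ) (fun w => g (v w)) w)) := by
  intro X _ _ _ _ _ U g u v A η hU hg hu hv hA hη
  -- the three null sets: critical values of `g ∘ u`, of `g ∘ v`, and `A`
  set Cu : Set ℂ := (fun z => g (u z)) '' {z ∈ u ⁻¹' U |
    ¬ Surjective (mfderiv 𝓘(ℝ, ℂ) 𝓘(ℝ, ℂ) (fun z => g (u z)) z)} with hCu
  set Cv : Set ℂ := (fun w => g (v w)) '' {w ∈ v ⁻¹' U |
    ¬ Surjective (mfderiv 𝓘(ℝ, ℂ) 𝓘(ℝ, ℂ) (fun w => g (v w)) w)} with hCv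
  have hCu0 : volume Cu = 0 := volume_image_not_surjective_mfderiv_comp_eq_zero hU hg hu
  have hCv0 : volume Cv = 0 := volume_image_not_surjective_mfderiv_comp_eq_zero hU hg hv
  have hA0 : volume A = 0 := hA.measure_zero volume
  have hN : volume (Cu ∪ Cv ∪ A) = 0 := measure_union_null (measure_union_null hCu0 hCv0) hA0
  -- the ball `B(0, η)` has positive measure, hence is not contained in the null set
  have hball : ¬ (ball (0 : ℂ) η ⊆ Cu ∪ Cv ∪ A) := fun hsub =>
    (measure_ball_pos volume (0 : ℂ) hη).ne' (measure_mono_null hsub hN)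
  obtain ⟨s, hsball, hsN⟩ := not_subset.1 hball
  refine ⟨s, mem_ball_zero_iff.1 hsball, fun hsA => hsN (Or.inr hsA), ?_, ?_⟩
  · exact surjective_mfderiv_of_notMem fun h => hsN (Or.inl (Or.inl h))
  · exact surjective_mfderiv_of_notMem fun h => hsN (Or.inl (Or.inr h))

end Summit.SmoothPoincare4.SmoothPoincare4.Theorems.GromovRecognitionRelEnd.CrossCapLaurent
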